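import Literature.NumberTheory.LFunctions.PatelYangBlockA
import HarnessLib

/-!
# Patel–Yang's Lemma 3.4: the `A`-process assembly of a top-range block

Topic `Literature/NumberTheory/LFunctions`. Patel–Yang 2024, proof of Lemma 3.4, §"Applying the
`A` process", (3.21)–(3.22): with the per-shift monomial bound
`Literature.NumberTheory.LFunctions.VdC.diffSum_block_monomial_le` and the explicit `A`-process
`…aProcess_yang`, summing the weights `(1 - r/q) r^s` by `…dhir_rpow_pos` / `…dhir_rpow_neg`
(Patel–Yang (1.8) and its extension to `s ∈ (-1, 0)`), we PROVE an explicit bound for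
`‖∑_{a<n≤L} n^{-it}‖²` on a block `a < L ≤ ha` with a free shift parameter `q ≥ 1`.

## References

* D. Patel, A. Yang, *An explicit sub-Weyl bound for `ζ(1/2 + it)`*, J. Number Theory 262 (2024),
  proof of Lemma 3.4, (3.21)–(3.22). [cite: PatelYang2024, Lemma 3.4]
-/

noncomputable section

open Real Set

namespace Literature.NumberTheory.LFunctions
namespace VdC

/-- `∑_{r<q} (1 - r/q)(Kr)^s ≤ K^s q^{1+s}/((1+s)(2+s))` for `0 < s ≤ 1`. [cite: PatelYang2024, Lemma 1.3] -/
theorem weightedSum_Krpow_le {K s : ℝ} (hK : 0 ≤ K) (hs0 : 0 < s) (hs1 : s ≤ 1) (q : ℕ) (hq : 1 ≤ q) :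
    ∑ r ∈ Finset.Ico 1 q, (1 - (r : ℝ) / q) * (K * r) ^ s
      ≤ K ^ s * ((q : ℝ) ^ (1 + s) / ((1 + s) * (2 + s))) := by
  have h1 : ∀ r ∈ Finset.Ico 1 q, (1 - (r : ℝ) / q) * (K * r) ^ s = K ^ s * ((1 - (r : ℝ) / q) * (r : ℝ) ^ s) := by
    intro r _
    rw [Real.mul_rpow hK (Nat.cast_nonneg r)]; ring
  rw [Finset.sum_congr rfl h1, ← Finset.mul_sum]
  exact mul_le_mul_of_nonneg_left (dhir_rpow_pos hs0 hs1 q hq) (Real.rpow_nonneg hK _)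

/-- `∑_{r<q} (1 - r/q)(Kr)^{-s} ≤ K^{-s} q^{1-s}/((1-s)(2-s))` for `0 < s < 1`. [cite: PatelYang2024, Lemma 1.3] -/
theorem weightedSum_Krpow_neg_le {K s : ℝ} (hK : 0 ≤ K) (hs0 : 0 < s) (hs1 : s < 1) (q : ℕ) (hq : 1 ≤ q) :
    ∑ r ∈ Finset.Ico 1 q, (1 - (r : ℝ) / q) * (K * r) ^ (-s)
      ≤ K ^ (-s) * ((q : ℝ) ^ (1 - s) / ((1 - s) * (2 - s))) := by
  have h1 : ∀ r ∈ Finset.Ico 1 q, (1 - (r : ℝ) / q) * (K * r) ^ (-s)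
      = K ^ (-s) * ((1 - (r : ℝ) / q) * (r : ℝ) ^ (-s)) := by
    intro r _
    rw [Real.mul_rpow hK (Nat.cast_nonneg r)]; ring
  rw [Finset.sum_congr rfl h1, ← Finset.mul_sum]
  have d := dhir_rpow_neg (s := -s) (by linarith) (by linarith) q hq
  have e : (q : ℝ) ^ (1 + -s) / ((1 + -s) * (2 + -s)) = (q : ℝ) ^ (1 - s) / ((1 - s) * (2 - s)) := by
    ring_nf
  rw [e] at d
  exact mul_le_mul_of_nonneg_left d (Real.rpow_nonneg hK _)

/-- `∑_{r<q} (1 - r/q) · c ≤ q c` for `c ≥ 0`. [folklore] -/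
theorem weightedSum_const_le {c : ℝ} (hc : 0 ≤ c) (q : ℕ) (hq : 1 ≤ q) :
    ∑ r ∈ Finset.Ico 1 q, (1 - (r : ℝ) / q) * c ≤ (q : ℝ) * c := by
  have hqpos : (0 : ℝ) < q := by exact_mod_cast hq
  calc ∑ r ∈ Finset.Ico 1 q, (1 - (r : ℝ) / q) * c ≤ ∑ _r ∈ Finset.Ico 1 q, c := by
        refine Finset.sum_le_sum fun r hr => ?_
        rw [Finset.mem_Ico] at hr
        have : 0 ≤ (r : ℝ) / q := by positivity
        nlinarith
    _ = ((q - 1 : ℕ) : ℝ) * c := by rw [Finset.sum_const, Nat.card_Ico, nsmul_eq_mul]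
    _ ≤ (q : ℝ) * c := by
        apply mul_le_mul_of_nonneg_right _ hc
        exact_mod_cast Nat.sub_le q 1

set_option maxHeartbeats 800000 in
/-- **The `A`-process bound for a top-range block** (Patel–Yang (3.21)–(3.22) with our constants):
for `t > 0` (`K = t/2π`), `1 < h`, `η > 0`, integers `1 ≤ a < L ≤ ha`, `q ≥ 1`, `N = L - a`:
`‖∑_{a<n≤L} e(-(t/2π) log n)‖² ≤ (N - 1 + q)(N/q + (2/q) T)` with
`T = c₀ a^{3/2} K^{-1/2} q^{1/2}/(3/4) + c₁ a^{-1/5} K^{11/30} q^{41/30}·900/2911 + c₂ a^{-11/20} K^{61/120} q^{181/120}·14400/54481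
 + q e₀ + e₁ a^{-2/3} K^{1/3} q^{4/3}·9/28 + e₂ a^{-2/5} K^{2/5} q^{7/5}·25/84`
(constants `c₀,…,e₂` of `…diffSum_block_monomial_le`). [cite: PatelYang2024, Lemma 3.4] -/
theorem topBlock_sq_le' {t h η : ℝ} (ht : 0 < t) (hh1 : 1 < h) (hη : 0 < η) {a L : ℤ}
    (ha : 1 ≤ a) (haL : a < L) (hL : (L : ℝ) ≤ h * a) {q : ℕ} (hq : 1 ≤ q) :
    ‖∑ n ∈ Finset.Ioc a L, e (phaseD t 0 n)‖ ^ 2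
      ≤ (((L : ℝ) - a) - 1 + q) * (((L : ℝ) - a) / q + 2 / q *
        ((3 + 50 * h ^ 8) / Real.sqrt 2 * (h * Real.sqrt h) * (a : ℝ) ^ (3 / 2 : ℝ)
            * ((t / (2 * π)) ^ (-(1 / 2 : ℝ)) * ((q : ℝ) ^ (1 - 1 / 2 : ℝ) / ((1 - 1 / 2) * (2 - 1 / 2))))
        + 3 / Real.sqrt 2 * (h * Real.sqrt h) * yangA η (h ^ 13) 5 * (h ^ 13) ^ (1 / 8 : ℝ)
            * (2 * (h - 1)) * (105 / 16 / h ^ 2) ^ (1 / 30 : ℝ) * (a : ℝ) ^ (-(1 / 5 : ℝ))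
            * ((t / (2 * π)) ^ (11 / 30 : ℝ) * ((q : ℝ) ^ (1 + 11 / 30 : ℝ) / ((1 + 11 / 30) * (2 + 11 / 30))))
        + 3 / Real.sqrt 2 * (h * Real.sqrt h) * yangB η 5 * (2 * (h - 1)) ^ (7 / 8 : ℝ)
            * ((105 / 16 / h ^ 2) ^ (1 / 30 : ℝ))⁻¹ * (a : ℝ) ^ (-(11 / 20 : ℝ))
            * ((t / (2 * π)) ^ (61 / 120 : ℝ) * ((q : ℝ) ^ (1 + 61 / 120 : ℝ) / ((1 + 61 / 120) * (2 + 61 / 120))))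
        + (q : ℝ) * (50 * h ^ 8 * (Real.log 2 + 3))
        + 50 * h ^ 8 * 3 * ((h - 1) / h ^ 3) ^ (1 / 3 : ℝ) * (a : ℝ) ^ (-(2 / 3 : ℝ))
            * ((t / (2 * π)) ^ (1 / 3 : ℝ) * ((q : ℝ) ^ (1 + 1 / 3 : ℝ) / ((1 + 1 / 3) * (2 + 1 / 3))))
        + 50 * h ^ 8 * (h - 1) * (12 / h ^ 7) ^ (1 / 5 : ℝ) * (a : ℝ) ^ (-(2 / 5 : ℝ))
            * ((t / (2 * π)) ^ (2 / 5 : ℝ) * ((q : ℝ) ^ (1 + 2 / 5 : ℝ) / ((1 + 2 / 5) * (2 + 2 / 5)))))) := by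
  have hK : 0 < t / (2 * π) := by positivity
  have hh0 : 0 < h := by linarith
  have ha0 : (0 : ℝ) < a := by exact_mod_cast (show (0 : ℤ) < a by omega)
  have hA5 : 0 < yangA η (h ^ 13) 5 := yangA_pos hη (one_le_pow₀ hh1.le) 5 (by norm_num)
  have hB5 : 0 < yangB η 5 := yangB_pos hη 5 (by norm_num)
  -- the A-process
  have hAP := aProcess_yang (fun y => phaseD t 0 y) haL.le hq
  beta_reduce at hAP
  refine hAP.trans ?_
  have hNq : 0 ≤ ((L : ℝ) - a) - 1 + q := by
    have : ((a : ℤ) : ℝ) + 1 ≤ L := by exact_mod_cast haL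
    have : (1 : ℝ) ≤ q := by exact_mod_cast hq
    linarith
  have h2q : (0 : ℝ) ≤ 2 / q := by positivity
  suffices hS : ∑ r ∈ Finset.Ico 1 q, (1 - (r : ℝ) / q)
      * ‖∑ n ∈ Finset.Ioc a (L - r), e (phaseD t 0 ((n + r : ℤ)) - phaseD t 0 n)‖ ≤ _ by
    exact mul_le_mul_of_nonneg_left (add_le_add le_rfl (mul_le_mul_of_nonneg_left hS h2q)) hNq
  -- the per-shift monomial bounds
  set c₀ : ℝ := (3 + 50 * h ^ 8) / Real.sqrt 2 * (h * Real.sqrt h) with hc₀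
  set c₁ : ℝ := 3 / Real.sqrt 2 * (h * Real.sqrt h) * yangA η (h ^ 13) 5 * (h ^ 13) ^ (1 / 8 : ℝ)
    * (2 * (h - 1)) * (105 / 16 / h ^ 2) ^ (1 / 30 : ℝ) with hc₁
  set c₂ : ℝ := 3 / Real.sqrt 2 * (h * Real.sqrt h) * yangB η 5 * (2 * (h - 1)) ^ (7 / 8 : ℝ)
    * ((105 / 16 / h ^ 2) ^ (1 / 30 : ℝ))⁻¹ with hc₂
  set e₀ : ℝ := 50 * h ^ 8 * (Real.log 2 + 3) with he₀
  set e₁ : ℝ := 50 * h ^ 8 * 3 * ((h - 1) / h ^ 3) ^ (1 / 3 : ℝ) with he₁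
  set e₂ : ℝ := 50 * h ^ 8 * (h - 1) * (12 / h ^ 7) ^ (1 / 5 : ℝ) with he₂
  have hh1' : 0 ≤ h - 1 := by linarith
  have hc₀0 : 0 ≤ c₀ := by positivity
  have hc₁0 : 0 ≤ c₁ := by positivity
  have hc₂0 : 0 ≤ c₂ := by positivity
  have hlog2 : 0 < Real.log 2 := Real.log_pos (by norm_num)
  have he₀0 : 0 ≤ e₀ := by positivity
  have hW0 : 0 ≤ (h - 1) / h ^ 3 := by positivity
  have he₁0 : 0 ≤ e₁ := by positivity
  have he₂0 : 0 ≤ e₂ := by positivity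
  have hterm : ∀ r ∈ Finset.Ico 1 q, (1 - (r : ℝ) / q)
      * ‖∑ n ∈ Finset.Ioc a (L - r), e (phaseD t 0 ((n + r : ℤ)) - phaseD t 0 n)‖
      ≤ c₀ * (a : ℝ) ^ (3 / 2 : ℝ) * ((1 - (r : ℝ) / q) * ((t / (2 * π)) * r) ^ (-(1 / 2 : ℝ)))
        + c₁ * (a : ℝ) ^ (-(1 / 5 : ℝ)) * ((1 - (r : ℝ) / q) * ((t / (2 * π)) * r) ^ (11 / 30 : ℝ))
        + c₂ * (a : ℝ) ^ (-(11 / 20 : ℝ)) * ((1 - (r : ℝ) / q) * ((t / (2 * π)) * r) ^ (61 / 120 : ℝ))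
        + (1 - (r : ℝ) / q) * e₀
        + e₁ * (a : ℝ) ^ (-(2 / 3 : ℝ)) * ((1 - (r : ℝ) / q) * ((t / (2 * π)) * r) ^ (1 / 3 : ℝ))
        + e₂ * (a : ℝ) ^ (-(2 / 5 : ℝ)) * ((1 - (r : ℝ) / q) * ((t / (2 * π)) * r) ^ (2 / 5 : ℝ)) := by
    intro r hr
    rw [Finset.mem_Ico] at hr
    have hqpos : (0 : ℝ) < q := by exact_mod_cast hq
    have hw : 0 ≤ 1 - (r : ℝ) / q := by
      rw [sub_nonneg, div_le_one hqpos]; exact_mod_cast hr.2.le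
    have hM := diffSum_block_monomial_le (η := η) ht hh1 hη ha hr.1 hL
    have := mul_le_mul_of_nonneg_left hM hw
    refine this.trans (le_of_eq ?_)
    rw [hc₀, hc₁, hc₂, he₀, he₁, he₂]; ring
  refine (Finset.sum_le_sum hterm).trans ?_
  simp only [Finset.sum_add_distrib, ← Finset.mul_sum]
  have s1 := weightedSum_Krpow_neg_le hK.le (by norm_num : (0:ℝ) < 1 / 2) (by norm_num) q hq
  have s2 := weightedSum_Krpow_le hK.le (by norm_num : (0:ℝ) < 11 / 30) (by norm_num) q hq
  have s3 := weightedSum_Krpow_le hK.le (by norm_num : (0:ℝ) < 61 / 120) (by norm_num) q hq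
  have s4 := weightedSum_const_le he₀0 q hq
  have s5 := weightedSum_Krpow_le hK.le (by norm_num : (0:ℝ) < 1 / 3) (by norm_num) q hq
  have s6 := weightedSum_Krpow_le hK.le (by norm_num : (0:ℝ) < 2 / 5) (by norm_num) q hq
  have ha32 : 0 ≤ c₀ * (a : ℝ) ^ (3 / 2 : ℝ) := by positivity
  have ha15 : 0 ≤ c₁ * (a : ℝ) ^ (-(1 / 5 : ℝ)) := by positivity
  have ha1120 : 0 ≤ c₂ * (a : ℝ) ^ (-(11 / 20 : ℝ)) := by positivity
  have ha23 : 0 ≤ e₁ * (a : ℝ) ^ (-(2 / 3 : ℝ)) := by positivity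
  have ha25 : 0 ≤ e₂ * (a : ℝ) ^ (-(2 / 5 : ℝ)) := by positivity
  have t1 := mul_le_mul_of_nonneg_left s1 ha32
  have t2 := mul_le_mul_of_nonneg_left s2 ha15
  have t3 := mul_le_mul_of_nonneg_left s3 ha1120
  have t5 := mul_le_mul_of_nonneg_left s5 ha23
  have t6 := mul_le_mul_of_nonneg_left s6 ha25
  linarith [t1, t2, t3, s4, t5, t6]

/-! ### Packaged form -/

/-- The bracket `T(t, h, η, a, q)` of the top-range block bound (the six monomial terms of
`…topBlock_sq_le'` after summing the shift weights). [cite: PatelYang2024, Lemma 3.4] -/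
def topBlockT (t h η a q : ℝ) : ℝ :=
  (3 + 50 * h ^ 8) / Real.sqrt 2 * (h * Real.sqrt h) * a ^ (3 / 2 : ℝ)
      * ((t / (2 * π)) ^ (-(1 / 2 : ℝ)) * (q ^ (1 - 1 / 2 : ℝ) / ((1 - 1 / 2) * (2 - 1 / 2))))
  + 3 / Real.sqrt 2 * (h * Real.sqrt h) * yangA η (h ^ 13) 5 * (h ^ 13) ^ (1 / 8 : ℝ)
      * (2 * (h - 1)) * (105 / 16 / h ^ 2) ^ (1 / 30 : ℝ) * a ^ (-(1 / 5 : ℝ))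
      * ((t / (2 * π)) ^ (11 / 30 : ℝ) * (q ^ (1 + 11 / 30 : ℝ) / ((1 + 11 / 30) * (2 + 11 / 30))))
  + 3 / Real.sqrt 2 * (h * Real.sqrt h) * yangB η 5 * (2 * (h - 1)) ^ (7 / 8 : ℝ)
      * ((105 / 16 / h ^ 2) ^ (1 / 30 : ℝ))⁻¹ * a ^ (-(11 / 20 : ℝ))
      * ((t / (2 * π)) ^ (61 / 120 : ℝ) * (q ^ (1 + 61 / 120 : ℝ) / ((1 + 61 / 120) * (2 + 61 / 120))))
  + q * (50 * h ^ 8 * (Real.log 2 + 3))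
  + 50 * h ^ 8 * 3 * ((h - 1) / h ^ 3) ^ (1 / 3 : ℝ) * a ^ (-(2 / 3 : ℝ))
      * ((t / (2 * π)) ^ (1 / 3 : ℝ) * (q ^ (1 + 1 / 3 : ℝ) / ((1 + 1 / 3) * (2 + 1 / 3))))
  + 50 * h ^ 8 * (h - 1) * (12 / h ^ 7) ^ (1 / 5 : ℝ) * a ^ (-(2 / 5 : ℝ))
      * ((t / (2 * π)) ^ (2 / 5 : ℝ) * (q ^ (1 + 2 / 5 : ℝ) / ((1 + 2 / 5) * (2 + 2 / 5))))

/-- `T ≥ 0` (`h > 1`, `η > 0`, `a > 0`, `q ≥ 0`, `t > 0`). [folklore] -/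
theorem topBlockT_nonneg {t h η a q : ℝ} (ht : 0 < t) (hh1 : 1 < h) (hη : 0 < η) (ha : 0 < a)
    (hq : 0 ≤ q) : 0 ≤ topBlockT t h η a q := by
  unfold topBlockT
  have hK : 0 < t / (2 * π) := by positivity
  have hh0 : 0 < h := by linarith
  have hh1' : 0 ≤ h - 1 := by linarith
  have hA5 : 0 < yangA η (h ^ 13) 5 := yangA_pos hη (one_le_pow₀ hh1.le) 5 (by norm_num)
  have hB5 : 0 < yangB η 5 := yangB_pos hη 5 (by norm_num)
  have hlog2 : 0 < Real.log 2 := Real.log_pos (by norm_num)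
  have hW0 : 0 ≤ (h - 1) / h ^ 3 := by positivity
  positivity

/-- **The top-range block bound** `𝓑(t, h, η, a, q) = √(((h-1)a - 1 + q)((h-1)a/q + (2/q)T))`.
[cite: PatelYang2024, Lemma 3.4] -/
def topBlockBound (t h η a q : ℝ) : ℝ :=
  Real.sqrt (((h - 1) * a - 1 + q) * ((h - 1) * a / q + 2 / q * topBlockT t h η a q))

/-- **Patel–Yang's Lemma 3.4 (our constants, free parameters)**: for `t > 0`, `1 < h`, `η > 0`,
integers `1 ≤ a < L ≤ ha` and `q ≥ 1`, `‖∑_{a<n≤L} e(-(t/2π) log n)‖ ≤ 𝓑(t, h, η, a, q)`; in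
particular the bound is uniform in `L`, as needed for partial summation. [cite: PatelYang2024, Lemma 3.4] -/
theorem topBlock_le {t h η : ℝ} (ht : 0 < t) (hh1 : 1 < h) (hη : 0 < η) {a L : ℤ}
    (ha : 1 ≤ a) (haL : a < L) (hL : (L : ℝ) ≤ h * a) {q : ℕ} (hq : 1 ≤ q) :
    ‖∑ n ∈ Finset.Ioc a L, e (phaseD t 0 n)‖ ≤ topBlockBound t h η a q := by
  have hsq := topBlock_sq_le' (η := η) ht hh1 hη ha haL hL hq
  have ha0 : (0 : ℝ) < a := by exact_mod_cast (show (0 : ℤ) < a by omega)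
  have hqpos : (0 : ℝ) < q := by exact_mod_cast hq
  have hT := topBlockT_nonneg (q := (q : ℝ)) ht hh1 hη ha0 hqpos.le
  have hN : (L : ℝ) - a ≤ (h - 1) * a := by linarith
  have hN1 : (1 : ℝ) ≤ (L : ℝ) - a := by
    have : ((a : ℤ) : ℝ) + 1 ≤ L := by exact_mod_cast haL
    linarith
  unfold topBlockBound
  rw [← Real.sqrt_sq (norm_nonneg (∑ n ∈ Finset.Ioc a L, e (phaseD t 0 n)))]
  refine Real.sqrt_le_sqrt (hsq.trans ?_)
  change ((L : ℝ) - a - 1 + q) * (((L : ℝ) - a) / q + 2 / q * topBlockT t h η a q)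
    ≤ ((h - 1) * a - 1 + q) * ((h - 1) * a / q + 2 / q * topBlockT t h η a q)
  have h1 : (L : ℝ) - a - 1 + q ≤ (h - 1) * a - 1 + q := by linarith
  have h2 : ((L : ℝ) - a) / q ≤ (h - 1) * a / q := div_le_div_of_nonneg_right hN hqpos.le
  have h3 : 0 ≤ ((L : ℝ) - a) / q + 2 / q * topBlockT t h η a q := by positivity
  have h4 : 0 ≤ (h - 1) * a - 1 + q := by linarith
  exact mul_le_mul h1 (by linarith) h3 h4

end VdC
end Literature.NumberTheory.LFunctions
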